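import Literature.Analysis.FluidPDE.NSLerayHopfSereginMild
import Literature.Analysis.FluidPDE.KatoLocalCovariance
import Literature.Analysis.FunctionSpaces.TestPairingLimits
import HarnessLib

/-!
# Seregin's `L³` criterion: the blow-up rescaling of a Kato solution (bookkeeping)

Analysis/FluidPDE support file (all results proved) for the assembly of the named fact
`Literature.Analysis.FluidPDE.seregin_regular_of_liminf_L3` (`NSLerayHopfSereginMild.lean`;
Lemarié-Rieusset 2016, proof of Thm. 15.5, PDF p. 570 of doi:10.1201/b19556; Seregin 2012,
§2 (2.3)) from the local-Leray facts of `NSSereginMildFacts.lean`. The printed proof passes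
from the Kato solution `u` on `[0, T)` and times `T_n ↑ T` to the rescaled, restarted fields
"`u_n(t,x) = √(1 − T_n) u(T_n + t(1 − T_n), √(1 − T_n) x)`" (p. 570; here, about a general
point `(T, x₀)`: `u_n(t, x) = λ_n u(T_n + λ_n² t, x₀ + λ_n x)`, `λ_n² = T − T_n`). This file
supplies the covariance bookkeeping in the tree's classes:

* `ContinuousInLpOn.comp_const_add`, `aestronglyMeasurable_uncurry_comp_const_add`,
  `isKatoSolutionOn_restart_of_mild` — restarting a Kato solution at a time `s`: continuity in
  `L³` and joint measurability translate in time; with the mild identity from the restarted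
  datum (the named fact `kato_restart`) one gets a Kato solution on `[0, T − s)`;
* `isKatoSolutionOn_blowup` — the parabolic blow-up `λ u(s + λ² t, x₀ + λ x)` of the restarted
  solution is a Kato solution on `[0, (T − s)/λ²)` (from the accepted
  `kato_local_rescale_translate`);
* `eLpNorm_top_uncurry_blowup` — essential suprema over backward cylinders transform by
  `ess sup_{Q_r(t₁, y)} |λ u(s + λ²·, x₀ + λ·)| = λ ess sup_{Q_{λr}(s + λ²t₁, x₀ + λy)} |u|`;
* `eLpNorm_three_blowupData`, `integral_inner_blowup_eq` — the `L³` norm and the pairings with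
  test fields of a rescaled slice `λ V(x₀ + λ ·)` (change of variables);
* `abs_integral_inner_le_eLpNorm_three_mul` — Hölder `|∫⟪f, φ⟫| ≤ ‖f‖₃ ‖φ‖_{3/2}`;
* `tendsto_integral_inner_blowup_of_memLp_three` — **rescalings of a fixed `L³` field vanish in
  `𝒟'`**: `∫ ⟪λ_n V(x₀ + λ_n x), φ(x)⟫ dx → 0` as `λ_n → 0⁺` (Lemarié-Rieusset p. 573: "this
  limit is equal to `0` since `u(1,.) ∈ L³`").

## References

* P. G. Lemarié-Rieusset, *The Navier–Stokes Problem in the 21st Century* (2016), proof of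
  Thm. 15.5, pp. 570 and 573.
* G. Seregin, Comm. Math. Phys. 312 (2012) = arXiv:1104.3615, §2, (2.3)–(2.4).
* W. Rusin, V. Šverák, J. Funct. Anal. 260 (2011), proof of Cor. 4.3 (the same normalisation).
-/

noncomputable section

open MeasureTheory TopologicalSpace Set Function Filter Metric
open _root_.Topology
open scoped ENNReal NNReal RealInnerProductSpace

namespace Literature.Analysis.FluidPDE

section General

variable {E : Type*} [NormedAddCommGroup E] [InnerProductSpace ℝ E] [FiniteDimensional ℝ E]
  [MeasurableSpace E] [BorelSpace E]
variable {F : Type*} [NormedAddCommGroup F] [NormedSpace ℝ F]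

/-! ### Time translation of the Kato clauses -/

omit [NormedSpace ℝ F] in
/-- **Time translation of `C(S; L^p)`**: if `u ∈ C(S; L^p)` then `t ↦ u(s + t)` lies in
`C(S'; L^p)` whenever `t ↦ s + t` maps `S'` into `S`. [folklore] -/
theorem ContinuousInLpOn.comp_const_add {S S' : Set ℝ} {p : ℝ≥0∞} {u : ℝ → E → F}
    (h : ContinuousInLpOn S p u) (s : ℝ) (hS : MapsTo (fun t => s + t) S' S) :
    ContinuousInLpOn S' p (fun t => u (s + t)) := by
  refine ⟨fun t ht => h.1 (s + t) (hS ht), fun t₀ ht₀ => ?_⟩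
  have hmap : Tendsto (fun t => s + t) (𝓝[S'] t₀) (𝓝[S] (s + t₀)) :=
    (continuous_const.add continuous_id).continuousWithinAt.tendsto_nhdsWithin hS
  exact (h.2 (s + t₀) (hS ht₀)).comp hmap

omit [NormedSpace ℝ F] in
/-- **Time translation of joint measurability on a strip**: if `u` is measurable on
`(0, T) × E` and `0 ≤ s`, then `(t, x) ↦ u(s + t, x)` is measurable on `(0, T − s) × E`
(the translation is measure preserving and maps the small strip into the large one). [folklore] -/
theorem aestronglyMeasurable_uncurry_comp_const_add {u : ℝ → E → F} {T s : ℝ} (hs : 0 ≤ s)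
    (hu : AEStronglyMeasurable (uncurry u) (volume.restrict (Ioo 0 T ×ˢ (univ : Set E)))) :
    AEStronglyMeasurable (uncurry fun t => u (s + t))
      (volume.restrict (Ioo 0 (T - s) ×ˢ (univ : Set E))) := by
  set θ : ℝ × E → ℝ × E := fun z => (s + z.1, z.2) with hθ
  have hθm : Measurable θ := (measurable_const.add measurable_fst).prodMk measurable_snd
  have hmp : MeasurePreserving θ (volume : Measure (ℝ × E)) volume := by
    have : θ = Prod.map (fun t : ℝ => s + t) id := by funext z; rfl
    rw [this, Measure.volume_eq_prod]
    exact (measurePreserving_add_left volume s).prod (MeasurePreserving.id volume)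
  have hpre : θ ⁻¹' (Ioo s T ×ˢ (univ : Set E)) = Ioo 0 (T - s) ×ˢ (univ : Set E) := by
    ext ⟨t, x⟩
    simp only [hθ, mem_preimage, mem_prod, mem_Ioo, mem_univ, and_true]
    constructor <;> rintro ⟨h1, h2⟩ <;> constructor <;> linarith
  have hq : Measure.QuasiMeasurePreserving θ
      (volume.restrict (Ioo 0 (T - s) ×ˢ (univ : Set E)))
      (volume.restrict (Ioo 0 T ×ˢ (univ : Set E))) := by
    refine ⟨hθm, ?_⟩
    rw [← hpre, ← Measure.restrict_map hθm (measurableSet_Ioo.prod MeasurableSet.univ),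
      hmp.map_eq]
    exact Measure.restrict_mono (prod_mono (Ioo_subset_Ioo_left hs) Subset.rfl) le_rfl
      |>.absolutelyContinuous
  have hcomp : (uncurry fun t => u (s + t)) = uncurry u ∘ θ := by
    funext ⟨t, x⟩; rfl
  rw [hcomp]
  exact hu.comp_quasiMeasurePreserving hq

end General

/-! ### Restart and blow-up of Kato solutions -/

section Kato

/-- **Restarting a Kato solution at time `s`**, given the mild identity from the restarted
datum (the content of the named fact `kato_restart`): `t ↦ u(s + t)` is a Kato solution on
`[0, T − s)` with datum `u(s)` — continuity in `L³` and measurability translate in time. [folklore] -/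
theorem isKatoSolutionOn_restart_of_mild {T ν s : ℝ}
    {u₀ : EuclideanSpace ℝ (Fin 3) → EuclideanSpace ℝ (Fin 3)}
    {u : ℝ → EuclideanSpace ℝ (Fin 3) → EuclideanSpace ℝ (Fin 3)}
    (hu : IsKatoSolutionOn T ν u₀ u) (hs : s ∈ Ico 0 T)
    (hmild : IsMildNSSolutionOn (Ico 0 (T - s)) ν 0 (u s) (fun t => u (s + t))) :
    IsKatoSolutionOn (T - s) ν (u s) (fun t => u (s + t)) := by
  refine ⟨hmild, hu.continuousInLpOn.comp_const_add s fun t ht => ?_, by simp,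
    aestronglyMeasurable_uncurry_comp_const_add hs.1 hu.aestronglyMeasurable⟩
  exact ⟨by linarith [hs.1, ht.1], by linarith [ht.2]⟩

/-- **The blow-up sequence consists of Kato solutions** (Lemarié-Rieusset 2016, p. 570:
"`u_n ∈ C([0,1), L³)`"; Seregin 2012, (2.3)): if `t ↦ u(s + t)` is a Kato solution on
`[0, T − s)` with datum `u(s)`, then for `λ > 0` and `x₀ ∈ ℝ³` the field
`(t, x) ↦ λ u(s + λ² t, x₀ + λ x)` is a Kato solution on `[0, (T − s)/λ²)` with datum
`λ u(s)(x₀ + λ ·)` (the accepted `kato_local_rescale_translate`). [cite: LemarieRieusset2016, proof of Thm. 15.5, p. 570] -/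
theorem isKatoSolutionOn_blowup {T ν s : ℝ}
    {u : ℝ → EuclideanSpace ℝ (Fin 3) → EuclideanSpace ℝ (Fin 3)}
    (h : IsKatoSolutionOn (T - s) ν (u s) (fun t => u (s + t))) {c : ℝ} (hc : 0 < c)
    (x₀ : EuclideanSpace ℝ (Fin 3)) :
    IsKatoSolutionOn ((T - s) / c ^ 2) ν (fun x => c • u s (x₀ + c • x))
      (fun t x => c • u (s + c ^ 2 * t) (x₀ + c • x)) := by
  obtain ⟨h1, h2, -, h4⟩ := kato_local_rescale_translate h.mild h.continuousInLpOn (by simp)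
    h.aestronglyMeasurable hc (-x₀)
  have e1 : (fun t x => c • (fun t => u (s + t)) (c ^ 2 * t) (c • x - -x₀)) =
      fun t x => c • u (s + c ^ 2 * t) (x₀ + c • x) := by
    funext t x; simp only [sub_neg_eq_add, add_comm (c • x) x₀]
  have e2 : rescaleData c (fun x => u s (x - -x₀)) = fun x => c • u s (x₀ + c • x) := by
    funext x; simp [rescaleData, sub_neg_eq_add, add_comm (c • x) x₀]
  rw [e1] at h1 h2 h4
  rw [e2] at h1
  refine ⟨h1, h2, ?_, h4⟩
  funext x
  simp

/-- **Essential suprema over backward cylinders under the blow-up map**: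
`ess sup_{Q_r(t₁, y)} |λ u(s + λ²·, x₀ + λ·)| = λ · ess sup_{Q_{λr}(s + λ² t₁, x₀ + λ y)} |u|`
(`λ > 0`; the map `(t, x) ↦ (s + λ² t, x₀ + λ x)` sends `Q_r(t₁, y)` onto
`Q_{λr}(s + λ²t₁, x₀ + λy)` and multiplies Lebesgue measure by a constant). [folklore] -/
theorem eLpNorm_top_uncurry_blowup (u : ℝ → EuclideanSpace ℝ (Fin 3) → EuclideanSpace ℝ (Fin 3))
    {c : ℝ} (hc : 0 < c) (s : ℝ) (x₀ : EuclideanSpace ℝ (Fin 3)) (r t₁ : ℝ)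
    (y : EuclideanSpace ℝ (Fin 3)) :
    eLpNorm (uncurry fun t x => c • u (s + c ^ 2 * t) (x₀ + c • x)) ∞
        (volume.restrict (parabolicCylinder r ((t₁ : ℝ), y))) =
      ‖c‖ₑ * eLpNorm (uncurry u) ∞
        (volume.restrict (parabolicCylinder (c * r) ((s + c ^ 2 * t₁ : ℝ), x₀ + c • y))) := by
  have h1 : uncurry (fun t x => c • u (s + c ^ 2 * t) (x₀ + c • x)) =
      c • (uncurry u ∘ stAffine (c ^ 2) c s x₀) := by
    funext ⟨t, x⟩
    simp [stAffine]
  rw [h1, eLpNorm_const_smul]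
  congr 1
  have hpre : stAffine (c ^ 2) c s x₀ ⁻¹' parabolicCylinder (c * r) ((s + c ^ 2 * t₁ : ℝ), x₀ + c • y) =
      parabolicCylinder r ((t₁ : ℝ), y) := by
    have hc2 : 0 < c ^ 2 := pow_pos hc 2
    simp only [parabolicCylinder]
    rw [stAffine_preimage_cylinder hc2 hc]
    congr 2
    · field_simp
      ring
    · field_simp
      ring
    · rw [add_sub_cancel_left, smul_smul, inv_mul_cancel₀ hc.ne', one_smul]
    · field_simp
  rw [← hpre, eLpNorm_top_comp_stAffine_restrict_preimage (pow_pos hc 2) hc]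

end Kato

/-! ### Rescaled slices: `L³` norm, pairings with test fields, and the vanishing limit -/

section Slices

variable {E : Type*} [NormedAddCommGroup E] [InnerProductSpace ℝ E] [FiniteDimensional ℝ E]
  [MeasurableSpace E] [BorelSpace E]

omit [FiniteDimensional ℝ E] [MeasurableSpace E] [BorelSpace E] in
/-- **Test fields are invariant under space dilations and translations**:
`φ(λ⁻¹(· − x₀))` is a test field for `λ ≠ 0`. [folklore] -/
theorem isTestFunctionOn_comp_inv_smul_sub {F : Type*} [NormedAddCommGroup F] [NormedSpace ℝ F]
    {φ : E → F} (hφ : FunctionSpaces.IsTestFunctionOn (⊤ : Opens E) φ) {c : ℝ} (hc : c ≠ 0)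
    (x₀ : E) :
    FunctionSpaces.IsTestFunctionOn (⊤ : Opens E) (fun y => φ (c⁻¹ • (y - x₀))) where
  contDiff := hφ.contDiff.comp ((contDiff_id.sub contDiff_const).const_smul _)
  hasCompactSupport := by
    have e : (fun y => φ (c⁻¹ • (y - x₀))) = φ ∘ (spaceAffineHomeomorph hc x₀).symm := by
      funext y; rfl
    rw [e]
    exact hφ.hasCompactSupport.comp_homeomorph _
  tsupport_subset := fun _ _ => trivial

/-- **Pairings of a rescaled slice** (change of variables `y = x₀ + λ x`, `dy = λ³ dx`):
`∫ ⟪λ V(x₀ + λx), φ(x)⟫ dx = λ · λ⁻³ ∫ ⟪V(y), φ(λ⁻¹(y − x₀))⟫ dy` on a three-dimensional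
space. [folklore] -/
theorem integral_inner_blowup_eq (hE : Module.finrank ℝ E = 3) (V : E → E) (φ : E → E)
    {c : ℝ} (hc : 0 < c) (x₀ : E) :
    ∫ x, ⟪c • V (x₀ + c • x), φ x⟫ = c * (c ^ 3)⁻¹ * ∫ y, ⟪V y, φ (c⁻¹ • (y - x₀))⟫ := by
  have h := integral_comp_space_affine hc x₀ (fun y => ⟪c • V y, φ (c⁻¹ • (y - x₀))⟫)
  have e : (fun x => ⟪c • V (x₀ + c • x), φ (c⁻¹ • (x₀ + c • x - x₀))⟫) =
      fun x => ⟪c • V (x₀ + c • x), φ x⟫ := by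
    funext x
    rw [add_sub_cancel_left, smul_smul, inv_mul_cancel₀ hc.ne', one_smul]
  rw [e] at h
  rw [h, hE, smul_eq_mul, ← integral_const_mul, ← integral_const_mul]
  refine integral_congr_ae (Eventually.of_forall fun y => ?_)
  simp only [real_inner_smul_left]
  ring

/-- **The `L³` norm of a rescaled, translated slice** in dimension three:
`‖λ V(x₀ + λ ·)‖₃ = ‖V‖₃` (`λ > 0`). [folklore] -/
theorem eLpNorm_three_blowupData (V : EuclideanSpace ℝ (Fin 3) → EuclideanSpace ℝ (Fin 3))
    {c : ℝ} (hc : 0 < c) (x₀ : EuclideanSpace ℝ (Fin 3)) :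
    eLpNorm (fun x => c • V (x₀ + c • x)) 3 volume = eLpNorm V 3 volume := by
  have e : (fun x => c • V (x₀ + c • x)) = rescaleData c (fun x => V (x - -x₀)) := by
    funext x; simp [rescaleData, sub_neg_eq_add, add_comm (c • x) x₀]
  rw [e, eLpNorm_three_rescaleData _ hc]
  have hme : MeasurableEmbedding (fun x : EuclideanSpace ℝ (Fin 3) => x - -x₀) :=
    (MeasurableEquiv.subRight (-x₀)).measurableEmbedding
  calc eLpNorm (fun x => V (x - -x₀)) 3 volume
      = eLpNorm V 3 (Measure.map (fun x => x - -x₀) volume) := (hme.eLpNorm_map_measure).symm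
    _ = eLpNorm V 3 volume := by rw [(measurePreserving_sub_right volume (-x₀)).map_eq]

/-- A rescaled, translated `L³` slice is an `L³` field (dimension three). [folklore] -/
theorem memLp_three_blowupData {V : EuclideanSpace ℝ (Fin 3) → EuclideanSpace ℝ (Fin 3)}
    (hV : MemLp V 3 volume) {c : ℝ} (hc : 0 < c) (x₀ : EuclideanSpace ℝ (Fin 3)) :
    MemLp (fun x => c • V (x₀ + c • x)) 3 volume := by
  have e : (fun x => c • V (x₀ + c • x)) = rescaleData c (fun x => V (x - -x₀)) := by
    funext x; simp [rescaleData, sub_neg_eq_add, add_comm (c • x) x₀]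
  rw [e]
  exact memLp_three_rescaleData
    (hV.comp_measurePreserving (measurePreserving_sub_right volume (-x₀))) hc

/-- A real integral of a nonnegative function is the real part of its `L¹` seminorm. [folklore] -/
theorem integral_eq_toReal_eLpNorm_one_of_nonneg {α : Type*} [MeasurableSpace α] {μ : Measure α}
    {g : α → ℝ} (hg : AEStronglyMeasurable g μ) (h0 : ∀ x, 0 ≤ g x) :
    ∫ x, g x ∂μ = (eLpNorm g 1 μ).toReal := by
  rw [eLpNorm_one_eq_lintegral_enorm, integral_eq_lintegral_of_nonneg_ae
    (Eventually.of_forall h0) hg]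
  congr 1
  exact lintegral_congr fun x => by
    rw [Real.enorm_eq_ofReal (h0 x)]

omit [FiniteDimensional ℝ E] [BorelSpace E] in
/-- **Hölder with exponents `(3, 3/2)` for the pairing of vector fields**:
`|∫ ⟪f, φ⟫| ≤ ‖f‖_{L³} ‖φ‖_{L^{3/2}}`. [folklore] -/
theorem abs_integral_inner_le_eLpNorm_three_mul {μ : Measure E} {f φ : E → E} (hf : MemLp f 3 μ)
    (hφ : MemLp φ (3 / 2 : ℝ≥0∞) μ) :
    |∫ x, ⟪f x, φ x⟫ ∂μ| ≤ (eLpNorm f 3 μ).toReal * (eLpNorm φ (3 / 2 : ℝ≥0∞) μ).toReal := by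
  -- the Hölder triple `(3/2, 3, 1)` (cf. `FunctionSpaces.holderTriple_threeHalves_three`)
  haveI : ENNReal.HolderTriple (3 / 2) 3 1 := by
    refine ⟨?_⟩
    have e1 : (3 / 2 : ℝ≥0∞) = ENNReal.ofReal (3 / 2) := by
      rw [ENNReal.ofReal_div_of_pos (by norm_num)]; simp
    have e2 : (3 : ℝ≥0∞) = ENNReal.ofReal 3 := by simp
    rw [inv_one, e1, e2, ← ENNReal.ofReal_inv_of_pos (by norm_num),
      ← ENNReal.ofReal_inv_of_pos (by norm_num), ← ENNReal.ofReal_add (by norm_num) (by norm_num),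
      ← ENNReal.ofReal_one]
    norm_num
  -- `‖φ‖ ‖f‖ ∈ L¹`
  have hA : MemLp (fun x => ‖f x‖) 3 μ := hf.norm
  have hB : MemLp (fun x => ‖φ x‖) (3 / 2 : ℝ≥0∞) μ := hφ.norm
  have hprod : MemLp (fun x => ‖φ x‖ * ‖f x‖) 1 μ := MemLp.mul' hA hB
  have hint : Integrable (fun x => ‖φ x‖ * ‖f x‖) μ := memLp_one_iff_integrable.1 hprod
  -- `|∫⟪f, φ⟫| ≤ ∫ ‖φ‖ ‖f‖`
  have h1 : ‖∫ x, ⟪f x, φ x⟫ ∂μ‖ ≤ ∫ x, ‖φ x‖ * ‖f x‖ ∂μ :=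
    norm_integral_le_of_norm_le hint (Eventually.of_forall fun x => by
      rw [mul_comm]; exact norm_inner_le_norm _ _)
  rw [Real.norm_eq_abs] at h1
  refine h1.trans ?_
  -- `∫ ‖φ‖ ‖f‖ = ‖ ‖φ‖ ‖f‖ ‖_{L¹} ≤ ‖φ‖_{3/2} ‖f‖₃`
  rw [integral_eq_toReal_eLpNorm_one_of_nonneg hprod.1 (fun x => by positivity)]
  have h2' : eLpNorm ((fun x => ‖φ x‖) • fun x => ‖f x‖) 1 μ ≤
      eLpNorm (fun x => ‖φ x‖) (3 / 2 : ℝ≥0∞) μ * eLpNorm (fun x => ‖f x‖) 3 μ :=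
    eLpNorm_smul_le_mul_eLpNorm (p := (3 / 2 : ℝ≥0∞)) (q := 3) (r := 1) hA.1 hB.1
  have hfun : ((fun x => ‖φ x‖) • fun x => ‖f x‖) = fun x => ‖φ x‖ * ‖f x‖ := by
    funext x
    rfl
  have h2 : eLpNorm (fun x => ‖φ x‖ * ‖f x‖) 1 μ ≤
      eLpNorm φ (3 / 2 : ℝ≥0∞) μ * eLpNorm f 3 μ := by
    rw [hfun, eLpNorm_norm, eLpNorm_norm] at h2'
    exact h2'
  have h3 := ENNReal.toReal_mono (ENNReal.mul_ne_top hφ.eLpNorm_ne_top hf.eLpNorm_ne_top) h2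
  rw [ENNReal.toReal_mul] at h3
  linarith [h3, mul_comm (eLpNorm φ (3 / 2 : ℝ≥0∞) μ).toReal (eLpNorm f 3 μ).toReal]

/-- **The `L^{3/2}` norm of a dilated test field** in dimension three:
`‖φ(λ⁻¹(· − x₀))‖_{3/2} = λ² ‖φ‖_{3/2}` (`λ > 0`). [folklore] -/
theorem eLpNorm_threeHalves_comp_inv_smul_sub (hE : Module.finrank ℝ E = 3) (φ : E → E)
    {c : ℝ} (hc : 0 < c) (x₀ : E) :
    eLpNorm (fun y => φ (c⁻¹ • (y - x₀))) (3 / 2 : ℝ≥0∞) volume =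
      ENNReal.ofReal (c ^ 2) * eLpNorm φ (3 / 2 : ℝ≥0∞) volume := by
  -- the dilation as a measurable embedding with `map = c³ • volume`
  have hme : MeasurableEmbedding (fun y : E => c⁻¹ • (y - x₀)) :=
    (spaceAffineHomeomorph hc.ne' x₀).symm.measurableEmbedding
  have hmap : Measure.map (fun y : E => c⁻¹ • (y - x₀)) (volume : Measure E) =
      ENNReal.ofReal (c ^ 3) • volume := by
    have h1 : (fun y : E => c⁻¹ • (y - x₀)) = (fun y => c⁻¹ • y) ∘ fun y => y - x₀ := rfl
    rw [h1, ← Measure.map_map (measurable_const_smul c⁻¹) (measurable_sub_const x₀),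
      (measurePreserving_sub_right volume x₀).map_eq, Measure.map_addHaar_smul volume
        (inv_ne_zero hc.ne'), hE]
    congr 2
    rw [inv_pow, inv_inv, abs_of_pos (pow_pos hc 3)]
  calc eLpNorm (fun y => φ (c⁻¹ • (y - x₀))) (3 / 2 : ℝ≥0∞) volume
      = eLpNorm φ (3 / 2 : ℝ≥0∞) (Measure.map (fun y : E => c⁻¹ • (y - x₀)) volume) :=
        (hme.eLpNorm_map_measure).symm
    _ = ENNReal.ofReal (c ^ 2) * eLpNorm φ (3 / 2 : ℝ≥0∞) volume := by
        rw [hmap, eLpNorm_smul_measure_of_ne_top (ENNReal.div_ne_top (by norm_num) (by norm_num)),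
          smul_eq_mul]
        congr 1
        rw [ENNReal.toReal_div, ENNReal.ofReal_rpow_of_pos (pow_pos hc 3)]
        congr 1
        rw [← Real.rpow_natCast, ← Real.rpow_mul hc.le]
        norm_num

/-- **Rescalings of a fixed `L³` field tend to `0` in the sense of distributions**
(Lemarié-Rieusset 2016, proof of Thm. 15.5, p. 573: the weak* limit of
`√(1 − T_{n_k}) u(1, √(1 − T_{n_k}) x)` "is equal to `0` since `u(1,.) ∈ L³`"). For
`V ∈ L³(E)`, `dim E = 3`, a test field `φ`, a point `x₀` and scales `λ_n → 0⁺`,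
`∫ ⟪λ_n V(x₀ + λ_n x), φ(x)⟫ dx → 0`: after the change of variables `y = x₀ + λ_n x` the pairing
is `λ_n⁻² ∫_{B(x₀, λ_n R)} ⟪V, φ(λ_n⁻¹(· − x₀))⟫`, bounded by Hölder by
`‖V‖_{L³(B(x₀, λ_n R))} ‖φ‖_{3/2}` (both factors scale critically), and
`∫_{B(x₀, λ_n R)} |V|³ → 0`. [cite: LemarieRieusset2016, proof of Thm. 15.5, p. 573] -/
theorem tendsto_integral_inner_blowup_of_memLp_three (hE : Module.finrank ℝ E = 3) {V : E → E}
    (hV : MemLp V 3 volume) {φ : E → E} (hφ : FunctionSpaces.IsTestFunctionOn (⊤ : Opens E) φ)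
    (x₀ : E) {c : ℕ → ℝ} (hc : ∀ n, 0 < c n) (hc0 : Tendsto c atTop (𝓝 0)) :
    Tendsto (fun n => ∫ x, ⟪c n • V (x₀ + c n • x), φ x⟫) atTop (𝓝 0) := by
  -- a ball containing the support of `φ`
  obtain ⟨R, hR, hRsupp⟩ : ∃ R : ℝ, 0 < R ∧ tsupport φ ⊆ ball (0 : E) R := by
    obtain ⟨R, hR⟩ := hφ.hasCompactSupport.isCompact.isBounded.subset_ball (0 : E)
    exact ⟨max R 1, by positivity, hR.trans (ball_subset_ball (le_max_left _ _))⟩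
  -- the dilated test fields `φ_n` and the truncations `V_n = 𝟙_{B(x₀, c n R)} V`
  set ψ : ℕ → E → E := fun n y => φ ((c n)⁻¹ • (y - x₀)) with hψ_def
  set B : ℕ → Set E := fun n => ball x₀ (c n * R) with hB_def
  have hψ0 : ∀ n, ∀ y, y ∉ B n → ψ n y = 0 := by
    intro n y hy
    show φ ((c n)⁻¹ • (y - x₀)) = 0
    refine image_eq_zero_of_notMem_tsupport fun hmem => hy ?_
    have h1 := hRsupp hmem
    rw [mem_ball_zero_iff, norm_smul, norm_inv, Real.norm_eq_abs, abs_of_pos (hc n),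
      inv_mul_lt_iff₀ (hc n)] at h1
    rw [hB_def, mem_ball, dist_eq_norm]
    linarith [mul_comm (c n) R]
  have hψtest : ∀ n, FunctionSpaces.IsTestFunctionOn (⊤ : Opens E) (ψ n) := fun n =>
    isTestFunctionOn_comp_inv_smul_sub hφ (hc n).ne' x₀
  have hψq : ∀ n, MemLp (ψ n) (3 / 2 : ℝ≥0∞) volume := fun n =>
    (hψtest n).contDiff.continuous.memLp_of_hasCompactSupport (hψtest n).hasCompactSupport
  have hVn : ∀ n, MemLp ((B n).indicator V) 3 volume := fun n => hV.indicator measurableSet_ball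
  -- ### the bound `|∫ ⟪c V(x₀ + c x), φ x⟫| ≤ ‖V‖_{L³(B n)} ‖φ‖_{3/2}`
  have hbound : ∀ n, |∫ x, ⟪c n • V (x₀ + c n • x), φ x⟫| ≤
      (eLpNorm ((B n).indicator V) 3 volume).toReal *
        (eLpNorm φ (3 / 2 : ℝ≥0∞) volume).toReal := by
    intro n
    have hcn := hc n
    rw [integral_inner_blowup_eq hE V φ hcn x₀]
    -- replace `V` by its truncation inside the pairing
    have hrep : ∫ y, ⟪V y, ψ n y⟫ = ∫ y, ⟪(B n).indicator V y, ψ n y⟫ := by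
      refine integral_congr_ae (Eventually.of_forall fun y => ?_)
      show ⟪V y, ψ n y⟫ = ⟪(B n).indicator V y, ψ n y⟫
      by_cases hy : y ∈ B n
      · rw [indicator_of_mem hy]
      · simp only [hψ0 n y hy, inner_zero_right]
    have hH := abs_integral_inner_le_eLpNorm_three_mul (hVn n) (hψq n)
    rw [show (fun y => ⟪V y, φ ((c n)⁻¹ • (y - x₀))⟫) = fun y => ⟪V y, ψ n y⟫ from rfl, hrep,
      abs_mul, abs_of_pos (by positivity : 0 < c n * (c n ^ 3)⁻¹)]
    refine (mul_le_mul_of_nonneg_left hH (by positivity)).trans_eq ?_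
    rw [show ψ n = fun y => φ ((c n)⁻¹ • (y - x₀)) from rfl,
      eLpNorm_threeHalves_comp_inv_smul_sub hE φ hcn x₀, ENNReal.toReal_mul,
      ENNReal.toReal_ofReal (by positivity)]
    field_simp
  -- ### `‖V‖_{L³(B n)} → 0`
  have hsmall : Tendsto (fun n => (eLpNorm ((B n).indicator V) 3 volume).toReal) atTop (𝓝 0) := by
    haveI : Nontrivial E := Module.nontrivial_of_finrank_pos (R := ℝ) (by rw [hE]; norm_num)
    have h3 : ∀ n, eLpNorm ((B n).indicator V) 3 volume =
        (∫⁻ y in B n, ‖V y‖ₑ ^ (3 : ℝ)) ^ ((3 : ℝ)⁻¹) := by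
      intro n
      rw [eLpNorm_indicator_eq_eLpNorm_restrict measurableSet_ball,
        eLpNorm_eq_lintegral_rpow_enorm_toReal (by norm_num) (by norm_num), ENNReal.toReal_ofNat,
        one_div]
    have hfin : ∫⁻ y, ‖V y‖ₑ ^ (3 : ℝ) ≠ ∞ := by
      have := lintegral_rpow_enorm_lt_top_of_eLpNorm_lt_top (by norm_num) (by norm_num)
        hV.eLpNorm_lt_top (f := V) (p := 3) (μ := volume)
      simpa using this.ne
    have hmeas : Tendsto (fun n => (volume : Measure E) (B n)) atTop (𝓝 0) := by
      have hform : ∀ n, (volume : Measure E) (B n) =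
          ENNReal.ofReal ((c n * R) ^ 3) * volume (ball (0 : E) 1) := by
        intro n
        rw [show B n = ball x₀ (c n * R) from rfl,
          Measure.addHaar_ball volume x₀ (mul_pos (hc n) hR).le, hE]
      simp_rw [hform]
      rw [← zero_mul (volume (ball (0 : E) 1))]
      refine ENNReal.Tendsto.mul_const ?_ (Or.inr measure_ball_lt_top.ne)
      rw [← ENNReal.ofReal_zero]
      refine ENNReal.tendsto_ofReal ?_
      have : Tendsto (fun n => (c n * R) ^ 3) atTop (𝓝 ((0 * R) ^ 3)) :=
        (hc0.mul_const R).pow 3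
      simpa using this
    have hlin : Tendsto (fun n => ∫⁻ y in B n, ‖V y‖ₑ ^ (3 : ℝ)) atTop (𝓝 0) :=
      tendsto_setLIntegral_zero hfin hmeas
    have hpow : Tendsto (fun n => (∫⁻ y in B n, ‖V y‖ₑ ^ (3 : ℝ)) ^ ((3 : ℝ)⁻¹)) atTop (𝓝 0) := by
      have := hlin.ennrpow_const ((3 : ℝ)⁻¹)
      rwa [ENNReal.zero_rpow_of_pos (by norm_num : (0 : ℝ) < 3⁻¹)] at this
    rw [← ENNReal.toReal_zero]
    refine (ENNReal.tendsto_toReal ENNReal.zero_ne_top).comp ?_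
    simpa [h3] using hpow
  -- ### conclusion
  have hlim : Tendsto (fun n => (eLpNorm ((B n).indicator V) 3 volume).toReal *
      (eLpNorm φ (3 / 2 : ℝ≥0∞) volume).toReal) atTop (𝓝 0) := by
    simpa using hsmall.mul_const (eLpNorm φ (3 / 2 : ℝ≥0∞) volume).toReal
  exact squeeze_zero_norm (fun n => by rw [Real.norm_eq_abs]; exact hbound n) hlim

end Slices

end Literature.Analysis.FluidPDE

end
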